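import Literature.NumberTheory.Weil1964.LocalQuadraticGaussIntegral
import Literature.NumberTheory.Weil1964.LocalGaussIntegralSeveralVariables
import HarnessLib

/-!
# Weil's Gauss integrals `g(a x², 𝔭ⁿ)`: local constancy in the coefficient `a`

Topic `NumberTheory/Weil1964`; namespace `Literature.NumberTheory.Weil1964` (sequel of `LocalQuadraticGaussIntegral.lean`).
KERNEL mathematics only: theorems, no definition, no named fact, no `sorry`.

For a non-archimedean local field `F`, an additive Haar measure `μ`, a character `ψ` of conductor exponent `d` and the
Gauss integrals `g(a, 𝔭ⁿ) = ∫_{𝔭ⁿ} ψ(a x²) dx` (`gaussBall ψ μ a n`) with stable value `g(a)` (`weilGauss ψ μ a`,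
[Weil1964] Chap. II n° 27): the integrand, hence the integral over `𝔭ⁿ`, only depends on `a` modulo `𝔭^{d-2n}`
(`gaussBall_congr_of_sub_mem`: `ψ((a-b)x²) = 1` on `𝔭ⁿ`), so that

* `weilGauss_congr_of_sub_mem` — two coefficients of the same absolute value `q^{-v}` which agree modulo `𝔭^{d-2n₀}`,
  `n₀` in the common stable range `2n₀ ≤ d - v - 2v₂`, have the SAME stable Gauss value `g(a) = g(b)`;
* `gaussBall_eq_weilGauss_of_sub_mem` — and then `g(b, 𝔭ⁿ) = g(a)` for EVERY `n ≤ n₀` (uniformly in the deep balls);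
* `normAbs_eq_of_normAbs_sub_lt` — the ultrametric bookkeeping `‖a - b‖ < ‖a‖ ⇒ ‖b‖ = ‖a‖` feeding the first hypothesis.

* §3 (appended): the one-variable box `(𝔭ⁿ)^{Fin 1}` — `setIntegral_primePowPiBox_fin_one`
  (`∫_{(𝔭ⁿ)^{Fin 1}} f(x₀) dμ^{⊗ Fin 1} = ∫_{𝔭ⁿ} f dμ`, Mathlib `measurePreserving_funUnique`),
  `setIntegral_primePowPiBox_psiSq_fin_one` (`= g(a, 𝔭ⁿ)`) — and the PACKAGED local constancy
  `exists_forall_gaussBall_eq_weilGauss_of_sub_mem`: for `a₀ ≠ 0` there are `m₀, N` with `g(a, 𝔭ⁿ) = g(a₀)` for all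
  `a ≡ a₀ (mod 𝔭^N)`, `n ≤ m₀`.

This is the «common Gauss value on deep boxes» step (W2) of the finite-level character computation for the rank-one
oscillator representation (cell hodgecm-mathlib, c3 wall, B-p04's carve 2026-08-28T05:45:53Z / H1): along a small open
subgroup of the torus the diagonal coefficient `a_z` of Weil's big-cell kernel varies continuously, and these lemmas turn
`|a_z| = |a_{z₀}|`, `a_z ≡ a_{z₀} (mod 𝔭^N)` into `g(a_z, 𝔭ⁿ) = g(a_{z₀})` for all `n ≤ n₀`.  HC_CM is not advanced by
this file alone.

## References
* [Weil1964] A. Weil, *Sur certains groupes d'opérateurs unitaires*, Acta Math. 111 (1964), Chap. II n° 24 (p. 172: the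
  second-degree character `χ ∘ f`), n° 27 (pp. 174–175: `g(f, M)` and its stabilisation).
-/

set_option autoImplicit false

noncomputable section

open MeasureTheory ValuativeRel Set
open scoped NNReal
open Literature.NumberTheory.GaloisRepresentations.IsNonarchimedeanLocalField
open Literature.NumberTheory.Automorphic

namespace Literature.NumberTheory.Weil1964

variable {F : Type*} [Field F] [ValuativeRel F] [TopologicalSpace F] [IsNonarchimedeanLocalField F]
  {ψ : AddChar F Circle}

/-- **Ultrametric bookkeeping**: `‖a - b‖ < ‖a‖ ⇒ ‖b‖ = ‖a‖`. [cite: Weil1964, Chap. II n° 27, p. 175] -/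
theorem normAbs_eq_of_normAbs_sub_lt {a b : F} (h : normAbs F (a - b) < normAbs F a) : normAbs F b = normAbs F a := by
  apply le_antisymm
  · have h1 := normAbs_add_le_max (F := F) a (-(a - b))
    rw [show a + -(a - b) = b by ring, normAbs_neg] at h1
    exact h1.trans (max_le le_rfl h.le)
  · have h2 := normAbs_add_le_max (F := F) b (a - b)
    rw [show b + (a - b) = a by ring] at h2
    rcases le_max_iff.1 h2 with h3 | h3
    · exact h3
    · exact absurd h3 (not_le.2 h)

/-- The second-degree characters of two coefficients agree where `(a - b) x² ∈ 𝔭^d` (`d` the conductor exponent):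
`ψ(a x²) = ψ(b x²) ψ((a-b) x²) = ψ(b x²)`. [cite: Weil1964, Chap. II n° 24, p. 172] -/
theorem psiSq_eq_of_sub_mul_sq_mem {d : ℤ} (hd : ψ.HasConductorExp d) {a b x : F}
    (h : (a - b) * x ^ 2 ∈ primePowBall F d) : psiSq ψ a x = psiSq ψ b x := by
  rw [psiSq_apply, psiSq_apply, show a * x ^ 2 = b * x ^ 2 + (a - b) * x ^ 2 by ring, AddChar.map_add_eq_mul,
    hd.1 _ h, mul_one]

/-- `a ≡ b (mod 𝔭^{d-2n})` implies `(a - b) x² ∈ 𝔭^d` for `x ∈ 𝔭ⁿ`. [cite: Weil1964, Chap. II n° 27, p. 175] -/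
theorem sub_mul_sq_mem_of_sub_mem {d n : ℤ} {a b : F} (hab : a - b ∈ primePowBall F (d - 2 * n)) {x : F}
    (hx : x ∈ primePowBall F n) : (a - b) * x ^ 2 ∈ primePowBall F d := by
  have h := mul_mem_primePowBall (mul_mem_primePowBall hab hx) hx
  rwa [show d - 2 * n + n + n = d by ring, mul_assoc, ← pow_two] at h

section Gauss

variable [MeasurableSpace F] [BorelSpace F] (μ : Measure F)

/-- **The Gauss integral over `𝔭ⁿ` only depends on the coefficient modulo `𝔭^{d-2n}`**:
`a ≡ b (mod 𝔭^{d-2n}) ⇒ g(a, 𝔭ⁿ) = g(b, 𝔭ⁿ)` (the integrands agree on `𝔭ⁿ`). [cite: Weil1964, Chap. II n° 27, p. 175] -/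
theorem gaussBall_congr_of_sub_mem {d : ℤ} (hd : ψ.HasConductorExp d) {a b : F} {n : ℤ}
    (hab : a - b ∈ primePowBall F (d - 2 * n)) : gaussBall ψ μ a n = gaussBall ψ μ b n := by
  rw [gaussBall_def, gaussBall_def]
  exact setIntegral_congr_fun (measurableSet_primePowBall n)
    fun x hx => psiSq_eq_of_sub_mul_sq_mem hd (sub_mul_sq_mem_of_sub_mem hab hx)

variable [μ.IsAddHaarMeasure]

/-- **Equal stable Gauss values for close coefficients**: if `‖a‖ = ‖b‖ = q^{-v}`, `‖2‖ = q^{-v₂}`, `2n₀ ≤ d - v - 2v₂`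
(the common stable range) and `a ≡ b (mod 𝔭^{d-2n₀})`, then `g(a) = g(b)`. [cite: Weil1964, Chap. II n° 27, p. 175] -/
theorem weilGauss_congr_of_sub_mem {d : ℤ} (hd : ψ.HasConductorExp d) {a b : F} {v : ℤ}
    (ha : normAbs F a = (residueFieldCard F : ℝ≥0)⁻¹ ^ v) (hb : normAbs F b = (residueFieldCard F : ℝ≥0)⁻¹ ^ v)
    {v₂ : ℤ} (h2 : normAbs F (2 : F) = (residueFieldCard F : ℝ≥0)⁻¹ ^ v₂) {n₀ : ℤ} (hn₀ : 2 * n₀ ≤ d - v - 2 * v₂)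
    (hab : a - b ∈ primePowBall F (d - 2 * n₀)) : weilGauss ψ μ a = weilGauss ψ μ b := by
  rw [weilGauss_eq_gaussBall μ hd ha h2 hn₀, weilGauss_eq_gaussBall μ hd hb h2 hn₀]
  exact gaussBall_congr_of_sub_mem μ hd hab

/-- **The Gauss integrals over all deep balls take the common stable value**: under the hypotheses of
`weilGauss_congr_of_sub_mem`, `g(b, 𝔭ⁿ) = g(a)` for every `n ≤ n₀`. [cite: Weil1964, Chap. II n° 27, p. 175] -/
theorem gaussBall_eq_weilGauss_of_sub_mem {d : ℤ} (hd : ψ.HasConductorExp d) {a b : F} {v : ℤ}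
    (ha : normAbs F a = (residueFieldCard F : ℝ≥0)⁻¹ ^ v) (hb : normAbs F b = (residueFieldCard F : ℝ≥0)⁻¹ ^ v)
    {v₂ : ℤ} (h2 : normAbs F (2 : F) = (residueFieldCard F : ℝ≥0)⁻¹ ^ v₂) {n₀ : ℤ} (hn₀ : 2 * n₀ ≤ d - v - 2 * v₂)
    (hab : a - b ∈ primePowBall F (d - 2 * n₀)) {n : ℤ} (hn : n ≤ n₀) : gaussBall ψ μ b n = weilGauss ψ μ a := by
  rw [gaussBall_eq_of_le μ hd hb h2 hn hn₀, ← weilGauss_eq_gaussBall μ hd hb h2 hn₀,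
    weilGauss_congr_of_sub_mem μ hd ha hb h2 hn₀ hab]

/-- The same with the closeness hypotheses in the form «`b` is `𝔭^{d-2n₀}`-close to `a` and closer to `a` than `‖a‖`»
(then `‖b‖ = ‖a‖` automatically): `g(b, 𝔭ⁿ) = g(a)` for every `n ≤ n₀`. [cite: Weil1964, Chap. II n° 27, p. 175] -/
theorem gaussBall_eq_weilGauss_of_sub_mem_of_lt {d : ℤ} (hd : ψ.HasConductorExp d) {a b : F} {v : ℤ}
    (ha : normAbs F a = (residueFieldCard F : ℝ≥0)⁻¹ ^ v) (hlt : normAbs F (a - b) < normAbs F a)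
    {v₂ : ℤ} (h2 : normAbs F (2 : F) = (residueFieldCard F : ℝ≥0)⁻¹ ^ v₂) {n₀ : ℤ} (hn₀ : 2 * n₀ ≤ d - v - 2 * v₂)
    (hab : a - b ∈ primePowBall F (d - 2 * n₀)) {n : ℤ} (hn : n ≤ n₀) : gaussBall ψ μ b n = weilGauss ψ μ a :=
  gaussBall_eq_weilGauss_of_sub_mem μ hd ha ((normAbs_eq_of_normAbs_sub_lt hlt).trans ha) h2 hn₀ hab hn

end Gauss


/-! ## §3 The one-variable box `(𝔭ⁿ)^{Fin 1}` and the packaged local constancy -/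

section FinOne

variable [MeasurableSpace F] [BorelSpace F] (μ : Measure F)

omit [BorelSpace F] in
/-- the box `(𝔭ⁿ)^{Fin 1}` is the preimage of the ball `𝔭ⁿ` under `x ↦ x₀`. [cite: Weil1964, Chap. II n° 27, p. 175] -/
theorem funUnique_preimage_primePowBall (n : ℤ) :
    (MeasurableEquiv.funUnique (Fin 1) F) ⁻¹' primePowBall F n = primePowPiBox F (Fin 1) n := by
  ext x
  simp only [mem_preimage, MeasurableEquiv.funUnique_apply, mem_primePowPiBox_iff]
  constructor
  · intro h i
    rwa [Subsingleton.elim i default]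
  · intro h
    exact h default

/-- **one-variable boxes**: `∫_{(𝔭ⁿ)^{Fin 1}} f(x₀) dμ^{⊗ Fin 1} = ∫_{𝔭ⁿ} f dμ` (the coordinate `x ↦ x₀` is a measure-preserving
measurable equivalence `F^{Fin 1} ≃ F`). [cite: Weil1964, Chap. II n° 25 Prop. 3, p. 173] -/
theorem setIntegral_primePowPiBox_fin_one (f : F → ℂ) (n : ℤ) :
    ∫ x in primePowPiBox F (Fin 1) n, f (x 0) ∂(Measure.pi fun _ : Fin 1 => μ) = ∫ y in primePowBall F n, f y ∂μ := by
  have h := (measurePreserving_funUnique μ (Fin 1)).setIntegral_preimage_emb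
    (MeasurableEquiv.funUnique (Fin 1) F).measurableEmbedding f (primePowBall F n)
  rw [funUnique_preimage_primePowBall] at h
  refine Eq.trans (setIntegral_congr_fun (measurableSet_primePowPiBox n) fun x _ => ?_) h
  simp only [MeasurableEquiv.funUnique_apply, Fin.default_eq_zero]

/-- in particular `∫_{(𝔭ⁿ)^{Fin 1}} ψ(a x₀²) dμ^{⊗ Fin 1} = g(a, 𝔭ⁿ)`. [cite: Weil1964, Chap. II n° 27, p. 175] -/
theorem setIntegral_primePowPiBox_psiSq_fin_one (a : F) (n : ℤ) :
    ∫ x in primePowPiBox F (Fin 1) n, psiSq ψ a (x 0) ∂(Measure.pi fun _ : Fin 1 => μ) = gaussBall ψ μ a n := by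
  rw [setIntegral_primePowPiBox_fin_one μ (psiSq ψ a) n, gaussBall_def]

variable [μ.IsAddHaarMeasure]

/-- **Gauss integrals over deep balls are locally constant in the coefficient, with the stable value** ([Weil1964] n° 27):
for `ψ` of conductor exponent `m`, `a₀ ≠ 0` and `2 ≠ 0` there are `m₀ N : ℤ` such that `g(a, 𝔭ⁿ) = g(a₀)` for every `a` with
`a - a₀ ∈ 𝔭^N` and every `n ≤ m₀`.  (Take `‖a₀‖ = q^{-v}`, `‖2‖ = q^{-v₂}`, `2m₀ ≤ m - v - 2v₂`, `N = max (v+1) (m - 2m₀)`: then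
`‖a - a₀‖ < ‖a₀‖`, so `‖a‖ = ‖a₀‖` is in the same stable range, and `ψ((a-a₀)x²) = 1` on `𝔭^{m₀}`.)
[cite: Weil1964, Chap. II n° 27, p. 175] -/
theorem exists_forall_gaussBall_eq_weilGauss_of_sub_mem {m : ℤ} (hm : ψ.HasConductorExp m) {a₀ : F} (ha₀ : a₀ ≠ 0)
    (htwo : (2 : F) ≠ 0) :
    ∃ m₀ N : ℤ, ∀ a : F, a - a₀ ∈ primePowBall F N → ∀ n ≤ m₀, gaussBall ψ μ a n = weilGauss ψ μ a₀ := by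
  obtain ⟨v, hv⟩ := exists_normAbs_eq_inv_zpow ha₀
  obtain ⟨v₂, hv₂⟩ := exists_normAbs_eq_inv_zpow htwo
  obtain ⟨m₀, hm₀⟩ : ∃ m₀ : ℤ, 2 * m₀ ≤ m - v - 2 * v₂ := ⟨min (m - v - 2 * v₂) 0, by omega⟩
  refine ⟨m₀, max (v + 1) (m - 2 * m₀), fun a ha n hn => ?_⟩
  have hsub : a₀ - a ∈ primePowBall F (max (v + 1) (m - 2 * m₀)) := by
    rw [show a₀ - a = -(a - a₀) by ring]
    exact neg_mem_primePowBall ha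
  have hlt : normAbs F (a₀ - a) < normAbs F a₀ := by
    have h1 : normAbs F (a₀ - a) ≤ (residueFieldCard F : ℝ≥0)⁻¹ ^ (v + 1) :=
      mem_primePowBall_iff.1 (primePowBall_antitone (le_max_left _ _) hsub)
    rw [hv]
    exact lt_of_le_of_lt h1 (zpow_lt_zpow_right_of_lt_one₀ inv_residueFieldCard_pos
      inv_residueFieldCard_lt_one (lt_add_one v))
  exact gaussBall_eq_weilGauss_of_sub_mem_of_lt μ hm hv hlt hv₂ hm₀
    (primePowBall_antitone (le_max_right _ _) hsub) hn

end FinOne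

end Literature.NumberTheory.Weil1964

end
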